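import Summits.ResolutionOfSingularities.ResolutionOfSingularities.Theorems.HilbertSamuelEliminationSigmaMaxModificationsCorridor3SigmaMenuSurfacePointStepNext
import Literature.AlgebraicGeometry.Resolution.PrimeDivisorIdeals
import HarnessLib

/-!
# [OURS · L1 W4.2] σ-LAYER PHASE B′ — `Corridor3SigmaMenuSurfaceStepNext`: the filtered trace configuration after a blow-up whose centre MEETS THE SURFACE
# INSIDE THE CONFIGURATION (general trace `Z = ι⁻¹ V(C) ⊆ S(E, D)`: a point of `S` — the F-75 point step; a curve of `S` — the CURE step; `Z = ∅` — a step
# elsewhere), and **ℓ IS UNCHANGED WHENEVER THE CENTRE'S TRACE ON THE SURFACE IS AN EFFECTIVE CARTIER DIVISOR** (cure curves on the regular surface; centres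
# disjoint from the surface): `surfaceSncLength (E.next C) (surfaceNext (blowup.π C) C D) = surfaceSncLength E D`
# (CRUX-PLAN w42 v3.13b/c (4) «curve step … ℓ unchanged», lex(ℓ, M); RULING v3.14-41 (JV)/(JW); crux chain w42 `SigmaMaxModifications`
# stmt-ResolutionOfSingularities-18506 / conjunct `SigmaMaxModificationsCorridor3` stmt-ResolutionOfSingularities-19249; helper of res-L1-w42-stub-1 (gen 5),
# `--supports stmt-…-19249 --as helper`, counted 0)

HONEST FRAMING. OURS bookkeeping generalising `…SigmaMenuSurfacePointStepNext` (p548141: point trace `Z = {q}`) to an arbitrary trace `Z ⊆ S(E, D)` of the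
centre on the reduced surface, over res-type-067's carrier glue (`…SigmaSurfaceStrictTransform`) and this seat's `sncLength_preimage_of_isIso` (p546417). The
Cartier-ness of the centre's trace `C|_D̃` is a HYPOTHESIS of the ℓ-invariance (`hcart`), discharged here for a centre NOT MEETING the surface (`C|_D̃ = ⊤`) and
for the CURE curve read as the reduced structure on an irreducible curve `cl{ζ}` of the regular surface (Literature `PrimeDivisorIdeals`). NOTHING here is a statement of
H. Hironaka's manuscript [Hironaka2017] nor of [CossartJannsenSaito2020]; no named fact. AI-written; AI review is weaker than expert review.

## Contents (namespace `…Theorems.SigmaMaxModificationsCorridor3.Sigma`)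

* §1 CORE WITH A GENERAL TRACE: `range_subset_support_iff_of_isSupportTransform_of_trace`, `not_range_subset_support_exceptional_of_trace`,
  **`divisorSet_restrictOff_eq_preimage_of_trace`** — along `j ≫ π = ρ ≫ ι`, for a boundary transform `E′` of `E` (`IsBoundaryTransform`, p548141) under the
  blow-up of a centre `C` with `ι⁻¹ V(C) = Z`, `Z ⊆ S(E,D) := (E.restrictOff ι).divisorSet`, `D̃ ∖ Z` dense with liftable points, `D̃_ρ ∖ ρ⁻¹Z` dense:
  `(E′.restrictOff j).divisorSet = ρ⁻¹ (E.restrictOff ι).divisorSet`.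
* §1b SUPPORT-LEVEL RECONCILIATION ON THE STAGE (RULING v3.14-41 (JV)): `Boundary.divisorSet_eq_of_isBoundaryTransform` (`⋃ supp E′ = π⁻¹(⋃ supp E) ∪ supp π^*C`),
  `Boundary.divisorSet_next`, `Boundary.divisorSet_completeTransformList`, **`Boundary.divisorSet_next_eq_completeTransformList`** (the run's saturated `E.next C`
  and CJS's `completeTransformList` have the same divisor set).
* §2 RUN LEVEL, CARTIER TRACE: **`surfaceSncLength_next_eq_of_isEffectiveCartier_trace`** — if `C|_D̃` is an effective Cartier divisor of the integral reduced
  surface (so `ρ = Bl_{C|_D̃} D̃ → D̃` is an isomorphism, `IsBlowup.isIso`) and `ι⁻¹ V(C) ⊆ S(E, D)`, then `ℓ(E.next C, surfaceNext (blowup.π C) C D) = ℓ(E, D)`;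
  instances **`surfaceSncLength_next_eq_of_disjoint`** (centre not meeting `D`: `C|_D̃ = ⊤`) and **`surfaceSncLength_next_eq_of_primeDivisor`** (THE CURE STEP:
  centre = the reduced curve on `cl{ζ} ⊆ S(E, D)`, `ζ` of codimension one in the REGULAR `D̃` — Cartier by Literature `isEffectiveCartier_primeDivisorIdeal_of_isRegular`).

VACUITY SELF-CHECK. §1 specialises to p548141's point core (`Z = {q}`) and to `Z = ∅`; §2's Cartier hypothesis is met by `⊤` (disjoint centres) and by the
reduced ideal of an irreducible curve on a regular surface (both PROVED here as instances).
-/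

noncomputable section

set_option linter.dupNamespace false -- mandated namespace of this single-conjunct summit

open CategoryTheory AlgebraicGeometry TopologicalSpace
open Summit.ResolutionOfSingularities.ResolutionOfSingularities.Theorems.CampaignW42
open Literature.AlgebraicGeometry.Resolution Literature.RingTheory.HilbertSamuel

namespace Summit.ResolutionOfSingularities.ResolutionOfSingularities.Theorems.SigmaMaxModificationsCorridor3.Sigma

universe u

open Scheme.IdealSheafData

/-! ## §1. The core with a general trace of the centre -/

section Core

variable {W W' D DZ : Scheme.{u}} {ι : D ⟶ W} {π : W' ⟶ W} {ρ : DZ ⟶ D} {j : DZ ⟶ W'} {C : W.IdealSheafData} {Z : Set D}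

/-- **(i) with a general trace**: a support transform contains the blown-up surface iff the member contains the surface, when the centre's trace `Z` on the
surface is nowhere dense with liftable complement. [folklore] -/
theorem range_subset_support_iff_of_isSupportTransform_of_trace (hsq : j ≫ π = ρ ≫ ι) (hC : ι.base ⁻¹' (C.support : Set W) = Z)
    (hlift : ∀ y : D, y ∉ Z → ∃ z : DZ, ρ.base z = y) (hDd : Dense (Zᶜ : Set D)) (hZd : Dense ((ρ.base ⁻¹' Z)ᶜ : Set DZ))
    {B : W.IdealSheafData} {B' : W'.IdealSheafData} (hB : IsSupportTransform π C B B') :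
    Set.range j.base ⊆ (B'.support : Set W') ↔ Set.range ι.base ⊆ (B.support : Set W) := by
  constructor
  · intro h
    have hA : IsClosed {y : D | ι.base y ∈ (B.support : Set W)} := B.support.isClosed.preimage ι.continuous
    have hsub : (Zᶜ : Set D) ⊆ {y : D | ι.base y ∈ (B.support : Set W)} := by
      intro y hy
      obtain ⟨z, hz⟩ := hlift y hy
      have h2 := hB.1 (h ⟨z, rfl⟩)
      rw [Set.mem_preimage, apply_comparison_eq hsq, hz] at h2
      exact h2
    have hAu := eq_univ_of_dense_subset hDd hA hsub
    rintro _ ⟨y, rfl⟩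
    have hy : y ∈ {y : D | ι.base y ∈ (B.support : Set W)} := hAu ▸ Set.mem_univ y
    exact hy
  · intro h
    have hA : IsClosed {z : DZ | j.base z ∈ (B'.support : Set W')} := B'.support.isClosed.preimage j.continuous
    have hsub : ((ρ.base ⁻¹' Z)ᶜ : Set DZ) ⊆ {z : DZ | j.base z ∈ (B'.support : Set W')} := by
      intro z hz
      have hnot : π.base (j.base z) ∉ (C.support : Set W) := by
        rw [apply_comparison_eq hsq]
        intro h'
        exact hz (show ρ.base z ∈ Z from hC ▸ h')
      change j.base z ∈ (B'.support : Set W')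
      rw [hB.2 _ hnot, apply_comparison_eq hsq]
      exact h ⟨ρ.base z, rfl⟩
    have hAu := eq_univ_of_dense_subset hZd hA hsub
    rintro _ ⟨z, rfl⟩
    have hz : z ∈ {z : DZ | j.base z ∈ (B'.support : Set W')} := hAu ▸ Set.mem_univ z
    exact hz

/-- **(iii) with a general trace**: the exceptional member does not contain the blown-up surface (the surface is non-empty and `D̃ ∖ Z` is dense).
[folklore] -/
theorem not_range_subset_support_exceptional_of_trace [Nonempty D] (hsq : j ≫ π = ρ ≫ ι) (hC : ι.base ⁻¹' (C.support : Set W) = Z)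
    (hlift : ∀ y : D, y ∉ Z → ∃ z : DZ, ρ.base z = y) (hDd : Dense (Zᶜ : Set D)) :
    ¬ Set.range j.base ⊆ ((C.comap π).support : Set W') := by
  intro h
  obtain ⟨y, hy⟩ := hDd.nonempty
  obtain ⟨z, hz⟩ := hlift y hy
  have h1 := h ⟨z, rfl⟩
  rw [Boundary.coe_support_comap, Set.mem_preimage, apply_comparison_eq hsq, hz] at h1
  exact hy (show y ∈ Z from hC ▸ h1)

/-- **THE CORE WITH A GENERAL TRACE** — along the square `j ≫ π = ρ ≫ ι`, for a boundary transform `E′` of `E` under the blow-up of a centre `C` whose trace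
`Z = ι⁻¹ V(C)` on the surface lies INSIDE the configuration: `(E′.restrictOff j).divisorSet = ρ⁻¹ (E.restrictOff ι).divisorSet`. General stage; `Z = {q}` is
p548141's point core, `Z = ∅` a centre elsewhere, `Z` a curve the cure step. [folklore] -/
theorem divisorSet_restrictOff_eq_preimage_of_trace (hsq : j ≫ π = ρ ≫ ι) (hC : ι.base ⁻¹' (C.support : Set W) = Z)
    (hlift : ∀ y : D, y ∉ Z → ∃ z : DZ, ρ.base z = y) (hDd : Dense (Zᶜ : Set D)) (hZd : Dense ((ρ.base ⁻¹' Z)ᶜ : Set DZ))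
    {E : Boundary W} {E' : Boundary W'} (hE : IsBoundaryTransform π C E E') (hZS : Z ⊆ (E.restrictOff ι).divisorSet) :
    (E'.restrictOff j).divisorSet = ρ.base ⁻¹' (E.restrictOff ι).divisorSet := by
  ext x
  rw [Set.mem_preimage, Boundary.mem_divisorSet_iff, Boundary.mem_divisorSet_iff]
  constructor
  · rintro ⟨J', hJ', hxJ'⟩
    obtain ⟨B', hB'E, hB'D, rfl⟩ := Boundary.mem_restrictOff_iff.mp hJ'
    rw [Boundary.coe_support_comap, Set.mem_preimage] at hxJ'
    rcases hE.2.1 B' hB'E with rfl | ⟨B, hBE, hBB'⟩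
    · -- the exceptional member: `ρ x ∈ Z ⊆ S`
      rw [Boundary.coe_support_comap, Set.mem_preimage, apply_comparison_eq hsq] at hxJ'
      have hx : ρ.base x ∈ Z := hC ▸ hxJ'
      exact Boundary.mem_divisorSet_iff.mp (hZS hx)
    · have hBD : ¬ Set.range ι.base ⊆ (B.support : Set W) :=
        fun h => hB'D ((range_subset_support_iff_of_isSupportTransform_of_trace hsq hC hlift hDd hZd hBB').mpr h)
      refine ⟨B.comap ι, Boundary.mem_restrictOff_iff.mpr ⟨B, hBE, hBD, rfl⟩, ?_⟩
      rw [Boundary.coe_support_comap, Set.mem_preimage, ← apply_comparison_eq hsq]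
      exact hBB'.1 hxJ'
  · rintro ⟨J, hJ, hxJ⟩
    obtain ⟨B, hBE, hBD, rfl⟩ := Boundary.mem_restrictOff_iff.mp hJ
    rw [Boundary.coe_support_comap, Set.mem_preimage] at hxJ
    haveI : Nonempty D := ⟨ρ.base x⟩
    by_cases hx : ρ.base x ∈ Z
    · refine ⟨(C.comap π).comap j, Boundary.mem_restrictOff_iff.mpr
        ⟨C.comap π, hE.2.2, not_range_subset_support_exceptional_of_trace hsq hC hlift hDd, rfl⟩, ?_⟩
      rw [Boundary.coe_support_comap, Set.mem_preimage, Boundary.coe_support_comap, Set.mem_preimage, apply_comparison_eq hsq]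
      rw [← hC] at hx
      exact hx
    · obtain ⟨B', hB'E, hBB'⟩ := hE.1 B hBE
      have hB'D : ¬ Set.range j.base ⊆ (B'.support : Set W') :=
        fun h => hBD ((range_subset_support_iff_of_isSupportTransform_of_trace hsq hC hlift hDd hZd hBB').mp h)
      refine ⟨B'.comap j, Boundary.mem_restrictOff_iff.mpr ⟨B', hB'E, hB'D, rfl⟩, ?_⟩
      have hnot : π.base (j.base x) ∉ (C.support : Set W) := by
        rw [apply_comparison_eq hsq]
        intro h'
        exact hx (show ρ.base x ∈ Z from hC ▸ h')
      rw [Boundary.coe_support_comap, Set.mem_preimage, hBB'.2 _ hnot, apply_comparison_eq hsq]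
      exact hxJ

end Core

/-! ## §1b. Support-level reconciliation on the stage: the divisor set of a boundary transform -/

section Stage

variable {W W' : Scheme.{u}} {π : W' ⟶ W} {C : W.IdealSheafData}

/-- **THE DIVISOR SET OF A BOUNDARY TRANSFORM** is the total transform of the divisor set together with the exceptional divisor:
`⋃ supp E′ = π⁻¹(⋃ supp E) ∪ supp(π^* C)` — for EVERY boundary transform with the support sandwich (RULING v3.14-41 (JV): the support-level reconciliation;
set-level consumers are transform-agnostic). [folklore] -/
theorem Boundary.divisorSet_eq_of_isBoundaryTransform {E : Boundary W} {E' : Boundary W'} (hE : IsBoundaryTransform π C E E') :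
    E'.divisorSet = π.base ⁻¹' E.divisorSet ∪ ((C.comap π).support : Set W') := by
  ext x
  rw [Set.mem_union, Set.mem_preimage, Boundary.mem_divisorSet_iff, Boundary.mem_divisorSet_iff]
  constructor
  · rintro ⟨B', hB'E, hxB'⟩
    rcases hE.2.1 B' hB'E with rfl | ⟨B, hBE, hBB'⟩
    · exact Or.inr hxB'
    · exact Or.inl ⟨B, hBE, hBB'.1 hxB'⟩
  · rintro (⟨B, hBE, hxB⟩ | hx)
    · by_cases hxC : π.base x ∈ (C.support : Set W)
      · refine ⟨C.comap π, hE.2.2, ?_⟩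
        rw [Boundary.coe_support_comap]
        exact hxC
      · obtain ⟨B', hB'E, hBB'⟩ := hE.1 B hBE
        exact ⟨B', hB'E, (hBB'.2 x hxC).mpr hxB⟩
    · exact ⟨C.comap π, hE.2.2, hx⟩

/-- **The run's next boundary**: `⋃ supp (E.next C) = π⁻¹(⋃ supp E) ∪ supp(π^* C)` for `π = blowup.π C`. [folklore] -/
theorem Boundary.divisorSet_next [IsLocallyNoetherian W] (E : Boundary W) (C : W.IdealSheafData) [IsLocallyNoetherian (blowup C)] :
    (E.next C).divisorSet = (blowup.π C).base ⁻¹' E.divisorSet ∪ ((C.comap (blowup.π C)).support : Set ↥(blowup C)) :=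
  Boundary.divisorSet_eq_of_isBoundaryTransform (isBoundaryTransform_next E C)

/-- **CJS's complete transform**: `⋃ supp (completeTransformList π C E) = π⁻¹(⋃ supp E) ∪ supp(π^* C)`. [cite: CossartJannsenSaito2020, Def. 5.7 (LNM 2270)] -/
theorem Boundary.divisorSet_completeTransformList [IsLocallyNoetherian W] [IsLocallyNoetherian W'] (hπ : IsBlowup π C) (E : Boundary W) :
    Boundary.divisorSet (completeTransformList π C E) = π.base ⁻¹' E.divisorSet ∪ ((C.comap π).support : Set W') :=
  Boundary.divisorSet_eq_of_isBoundaryTransform (isBoundaryTransform_completeTransformList hπ E)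

/-- **SUPPORT-LEVEL RECONCILIATION (RULING v3.14-41 (JV))**: the run's `E.next C` (saturated strict transforms) and CJS's `completeTransformList` (principal strict
transforms) have THE SAME DIVISOR SET. [folklore] -/
theorem Boundary.divisorSet_next_eq_completeTransformList [IsLocallyNoetherian W] (E : Boundary W) (C : W.IdealSheafData) [IsLocallyNoetherian (blowup C)] :
    (E.next C).divisorSet = Boundary.divisorSet (completeTransformList (blowup.π C) C E) := by
  rw [Boundary.divisorSet_next, Boundary.divisorSet_completeTransformList (blowup.isBlowup C)]

end Stage

/-! ## §2. Run level: ℓ is unchanged when the centre's trace is an effective Cartier divisor of the surface -/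

section Run

variable {W : Scheme.{u}} {E : Boundary W} {D : Closeds W} {C : W.IdealSheafData}

/-- **ℓ IS UNCHANGED WHEN THE CENTRE'S TRACE IS CARTIER AND INSIDE THE CONFIGURATION.** For an irreducible surface `D` with reduced structure `D̃`, a centre
`C` of the locally Noetherian stage whose restriction `C|_D̃` is an effective Cartier divisor of `D̃` (so the blow-up `ρ` of `D̃` along it is an isomorphism)
with trace `ι⁻¹ V(C) ⊆ S(E, D)`: `ℓ(E.next C, surfaceNext (blowup.π C) C D) = ℓ(E, D)` — THE CURE STEP and every Cartier-trace step leave the ℓ-coordinate of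
`lex(ℓ, M)` fixed. [folklore] -/
theorem surfaceSncLength_next_eq_of_isEffectiveCartier_trace [IsLocallyNoetherian W] (hDirr : IsIrreducible (D : Set W))
    (hcart : IsEffectiveCartier (C.comap (menuCentre D).subschemeι))
    (hZS : (menuCentre D).subschemeι.base ⁻¹' (C.support : Set W) ⊆ surfaceTraceSet E D) :
    surfaceSncLength (E.next C) (surfaceNext (blowup.π C) C D) = surfaceSncLength E D := by
  haveI : IsProper (blowup.π C) := (blowup.isBlowup C).isProper
  haveI : IsLocallyNoetherian (blowup C) := LocallyOfFiniteType.isLocallyNoetherian (blowup.π C)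
  set ι := (menuCentre D).subschemeι with hι
  have hπ := blowup.isBlowup C
  have hρ := blowup.isBlowup (C.comap ι)
  set ρ := blowup.π (C.comap ι) with hρdef
  -- `ρ` is an isomorphism; the surface and its blow-up are integral
  haveI : IsIso ρ := hρ.isIso hcart
  haveI : IsIntegral (menuCentre D).subscheme := isIntegral_subscheme_vanishingIdeal D hDirr
  haveI : IsLocallyNoetherian (menuCentre D).subscheme := LocallyOfFiniteType.isLocallyNoetherian ι
  haveI : IsReduced (blowup (C.comap ι)) := hρ.isReduced_of_isReduced
  obtain ⟨e, he⟩ := exists_iso_menuCentre_surfaceNext hπ hρ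
  -- the core with trace `Z := ι⁻¹ V(C)`: points lift because `ρ` is surjective
  have hlift : ∀ y : ↥(menuCentre D).subscheme, y ∉ ι.base ⁻¹' (C.support : Set W) → ∃ z, ρ.base z = y :=
    fun y _ => ρ.surjective y
  -- density: a Cartier trace misses the generic point of the integral surface, so its complement is a non-empty open, hence dense
  have hDd : Dense ((ι.base ⁻¹' (C.support : Set W))ᶜ : Set ↥(menuCentre D).subscheme) := by
    -- the support of an effective Cartier divisor on an integral scheme misses the generic point
    rw [← Boundary.coe_support_comap]
    by_cases hne : (((C.comap ι).support : Set ↥(menuCentre D).subscheme)ᶜ).Nonempty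
    · exact ((C.comap ι).support.isClosed.isOpen_compl).dense hne
    · -- an effective Cartier ideal cannot have full support: it would contain the generic point
      exfalso
      rw [Set.not_nonempty_iff_eq_empty, Set.compl_empty_iff] at hne
      have hgen : genericPoint ↥(menuCentre D).subscheme ∈ ((C.comap ι).support : Set ↥(menuCentre D).subscheme) := hne ▸ Set.mem_univ _
      exact DeJong1996.NormalProjectivePair.genericPoint_notMem_support hcart hgen
  have hZd : Dense ((ρ.base ⁻¹' (ι.base ⁻¹' (C.support : Set W)))ᶜ : Set ↥(blowup (C.comap ι))) := by
    rw [← Set.preimage_compl]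
    exact hDd.preimage (Scheme.homeoOfIso (asIso ρ)).isOpenMap
  have hcore := divisorSet_restrictOff_eq_preimage_of_trace (hπ.strictTransformHom_comp hρ) rfl hlift hDd hZd (isBoundaryTransform_next E C) hZS
  rw [surfaceSncLength_eq (E.next C), ← sncLength_preimage_of_iso e, preimage_surfaceTraceSet_surfaceNext hπ hρ e he, hcore, ← surfaceTraceSet_eq,
    surfaceSncLength_eq]
  exact sncLength_preimage_of_isIso ρ

/-- The trace of a centre NOT MEETING the surface is the unit ideal. [folklore] -/
theorem comap_subschemeι_eq_top_of_disjoint (hdisj : Disjoint (D : Set W) (C.support : Set W)) : C.comap (menuCentre D).subschemeι = ⊤ := by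
  rw [← Scheme.IdealSheafData.support_eq_bot_iff, Scheme.IdealSheafData.support_comap]
  ext y
  simp only [Closeds.coe_preimage, Set.mem_preimage, Closeds.coe_bot, Set.mem_empty_iff_false, iff_false]
  exact fun hy => Set.disjoint_left.mp hdisj (subschemeι_mem D y) hy

/-- **A STEP ELSEWHERE LEAVES ℓ UNCHANGED**: if the centre does not meet the irreducible surface `D`, then `ℓ(E.next C, surfaceNext (blowup.π C) C D) = ℓ(E, D)`.
[folklore] -/
theorem surfaceSncLength_next_eq_of_disjoint [IsLocallyNoetherian W] (hDirr : IsIrreducible (D : Set W)) (hdisj : Disjoint (D : Set W) (C.support : Set W)) :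
    surfaceSncLength (E.next C) (surfaceNext (blowup.π C) C D) = surfaceSncLength E D := by
  refine surfaceSncLength_next_eq_of_isEffectiveCartier_trace hDirr ?_ ?_
  · rw [comap_subschemeι_eq_top_of_disjoint hdisj]
    exact isEffectiveCartier_top
  · intro y hy
    exact absurd hy (Set.disjoint_left.mp hdisj (subschemeι_mem D y))

/-- **THE CURE STEP LEAVES ℓ UNCHANGED.** If the centre is the reduced curve `ι(c̄)` of `W` on an irreducible curve `c̄ = cl{ζ} ⊆ S(E, D)` of the REGULAR
reduced surface `D̃` (`ζ` a point of codimension one of `D̃`), then its trace `𝓘(c̄)` is an effective Cartier divisor of `D̃` (prime divisors on a regular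
integral scheme are Cartier: Literature `isEffectiveCartier_primeDivisorIdeal_of_isRegular`, GW Thm. 11.40 (2)) and
`ℓ(E.next C, surfaceNext (blowup.π C) C D) = ℓ(E, D)`. [folklore] -/
theorem surfaceSncLength_next_eq_of_primeDivisor [IsLocallyNoetherian W] (hDirr : IsIrreducible (D : Set W))
    (hreg : Scheme.IsRegular (menuCentre D).subscheme) {ζ : ↥(menuCentre D).subscheme} (hζ : Order.coheight ζ = 1)
    (hC : C = vanishingIdeal ⟨(menuCentre D).subschemeι '' closure {ζ}, (menuCentre D).subschemeι.isClosedEmbedding.isClosedMap _ isClosed_closure⟩)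
    (hZS : closure {ζ} ⊆ surfaceTraceSet E D) :
    surfaceSncLength (E.next C) (surfaceNext (blowup.π C) C D) = surfaceSncLength E D := by
  set ι := (menuCentre D).subschemeι with hι
  haveI : IsIntegral (menuCentre D).subscheme := isIntegral_subscheme_vanishingIdeal D hDirr
  haveI : IsLocallyNoetherian (menuCentre D).subscheme := LocallyOfFiniteType.isLocallyNoetherian ι
  have hCι : C.comap ι = primeDivisorIdeal ζ := by
    rw [hC, primeDivisorIdeal]
    exact comap_vanishingIdeal_image_of_isClosedImmersion ι ⟨closure {ζ}, isClosed_closure⟩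
  refine surfaceSncLength_next_eq_of_isEffectiveCartier_trace hDirr ?_ ?_
  · rw [hCι]
    exact isEffectiveCartier_primeDivisorIdeal_of_isRegular hreg hζ
  · intro y hy
    rw [Set.mem_preimage, hC, Scheme.IdealSheafData.coe_support_vanishingIdeal] at hy
    obtain ⟨y', hy', hyy'⟩ := hy
    rw [← ι.isClosedEmbedding.injective hyy']
    exact hZS hy'

end Run

end Summit.ResolutionOfSingularities.ResolutionOfSingularities.Theorems.SigmaMaxModificationsCorridor3.Sigma

end
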